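/- Free-seat work of EXTRA WIDTH SEAT `ym-line-cbag-p1-w5` (prover-ym-line-cbag-p1-w5-g2-0), route `EguchiKawaiDirectionLadder`
(ideator ym-idea-2, LINE 8): the route-posited objects of the REGISTERED birth skeleton v6 of crux `TripleSmallBallMargin`
(stmt-QuantumFields-27724; planner ym-idea-2 g7, HOME/l8/bc/TripleSmallBallMargin_birth_v6.lean, skeleton sha 6c95f0d47562…; reshape =
width seat w4's sizing note + proposal, `t ≤ 1` repair = this seat's stub-misstated note) VERBATIM, so that the two registered stubs
`stub_freeTripleSmallBallRobust : FreeTripleSmallBallRobust` (a♯, XL) and `stub_offBlockDecouplingRobust : OffBlockDecouplingRobust` (b♯, L)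
can be landed by name from importable definitions; plus the skeleton's PROVED bookkeeping ((a♯) ⇒ (a′), composition).  No claim about
the stubs.  The route bears on the barrier-ledger fact `EguchiKawaiBreakdown`; the Yang–Mills mass gap is NOT proved by anything here. -/
import Summits.QuantumFields.YangMills.Theorems.EguchiKawaiDirectionLadderTripleSmallBallMarginProfile
import Literature.Barriers.QuantumFields.EguchiKawaiBreakdownLowerBound
import HarnessLib

/-!
# Route `EguchiKawaiDirectionLadder`, crux `TripleSmallBallMargin` (stmt-QuantumFields-27724): the v6 skeleton's objects

Skeleton v6 (registered 2026-08-28T13:43Z) keeps the crux, the tree's `ProfileResolvedBound`, and the LANDED glue (d)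
`centreSymmetricProfile_proof`, (c) `marginComposition_proof` (`EguchiKawaiDirectionLadderTripleSmallBallMarginProfile`), and replaces
the two random-matrix levels by RANK-ROBUST versions:

* (a♯) `FreeTripleSmallBallRobust` — the within-cluster `N`-uniform small-ball bound with exponent `3/4 − η` for triples whose pairwise
  commutators are `4N·t`-small in total squared Frobenius norm AFTER subtracting corrections of rank `≤ κN`, for `0 < t ≤ 1` (XL,
  load-bearing; `R ≡ 0` and `t ≤ 1` give the corrected v5 stub (a′) = `FreeTripleSmallBallLe1`; the tree's v5 object `FreeTripleSmallBall`
  quantifies over all `t > 0` and is false as typed, `not_freeTripleSmallBall`);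
* (b♯) `OffBlockDecouplingRobust := FreeTripleSmallBallRobust → ProfileResolvedBound` (L).

This file DECLARES these objects byte-for-byte as in the registered skeleton (namespace moved from `…Theses.EguchiKawaiDirectionLadder.BirthKA6`
to the route's Theorems namespace) together with the skeleton's proved lemmas `sum_frobSq_ekComm_eq`, `actionEvent_subset_robustEvent`,
`freeTripleSmallBallLe1_of_robust` ((a♯) ⇒ (a′)) and the kernel-checked composition `tripleSmallBallMargin_of_robust_stubs`
((a♯) → (b♯) → crux BY NAME through the landed (d), (c)).  Nothing is claimed about (a♯), (b♯).
-/

set_option autoImplicit false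

noncomputable section

open MeasureTheory
open scoped Classical
open Literature.Barriers.QuantumFields

namespace Summit.QuantumFields.YangMills.Theorems.EguchiKawaiDirectionLadder

/-- STUB (a♯) of the registered skeleton v6 of stmt-QuantumFields-27724, verbatim — RANK-ROBUST WITHIN-CLUSTER LEVEL (XL, load-bearing):
for every `η > 0` there are `κ = κ(η) > 0`, `C ≥ 0`, `N₀` such that for `N ≥ N₀` and `0 < t ≤ 1` the Haar measure of the triples
`(U₁,U₂,U₃) ∈ U(N)³` whose pairwise commutators are `4N·t`-small in total squared Frobenius norm after subtracting corrections `R μ ν`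
of rank `≤ κ·N` is at most `exp(N²((3/4 − η) log t + C))`.  (`t ≤ 1` is essential — `S_R ≤ 9` always; `N₀ ≥ 4` is forced —
Austing–Wheater 2001, App. A.) -/
def FreeTripleSmallBallRobust : Prop :=
  ∀ η : ℝ, 0 < η → ∃ κ : ℝ, 0 < κ ∧ ∃ C : ℝ, 0 ≤ C ∧ ∃ N₀ : ℕ, ∀ N : ℕ, N₀ ≤ N → ∀ t : ℝ, 0 < t → t ≤ 1 →
    ekHaar 3 N {U | ∃ R : Fin 3 → Fin 3 → Matrix (Fin N) (Fin N) ℂ,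
        (∀ μ ν, ((R μ ν).rank : ℝ) ≤ κ * N) ∧
        ∑ μ, ∑ ν, frobSq (ekComm U μ ν - R μ ν) ≤ 4 * N * t} ≤
      ENNReal.ofReal (Real.exp ((N : ℝ) ^ 2 * ((3 / 4 - η) * Real.log t + C)))

/-- STUB (b♯) of the registered skeleton v6 of stmt-QuantumFields-27724, verbatim — OFF-DIAGONAL-BLOCK LEVEL with rank-robust input (L):
the profile-resolved bound (tree decl `ProfileResolvedBound`, unchanged) from (a♯); inside the adjacent-arc band the within-cluster bound
is applied to the COMPRESSIONS `(U_μ)_II`, whose unitary defect has a near part of rank `≤ κ|I|` — exactly the freedom (a♯) grants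
(width seat w4's sizing note, evidence #7 on the item). -/
def OffBlockDecouplingRobust : Prop := FreeTripleSmallBallRobust → ProfileResolvedBound

/-- The CORRECTED v5 within-cluster stub (a′), verbatim from skeleton v6: `FreeTripleSmallBall` with the missing restriction `t ≤ 1`
(the tree's v5 object without it is false at large `t`, `not_freeTripleSmallBall`). -/
def FreeTripleSmallBallLe1 : Prop :=
  ∀ η : ℝ, 0 < η → ∃ C : ℝ, 0 ≤ C ∧ ∃ N₀ : ℕ, ∀ N : ℕ, N₀ ≤ N → ∀ t : ℝ, 0 < t → t ≤ 1 →
    ekHaar 3 N {U | ekAction U ≤ t} ≤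
      ENNReal.ofReal (Real.exp ((N : ℝ) ^ 2 * ((3 / 4 - η) * Real.log t + C)))

/-! ### (a♯) ⇒ (a′): the rank-0 case of the robust event is the action event (skeleton v6, proved) -/

/-- `Σ_{μ,ν} ‖[U_μ,U_ν]‖_F² = 4N · S_R[U]` for `N ≥ 1` (the tree's `ekAction_eq_sum_ekCommNormSq`, rearranged). -/
theorem sum_frobSq_ekComm_eq {N : ℕ} (hN : 0 < N) (U : EKConfig 3 N) :
    ∑ μ, ∑ ν, frobSq (ekComm U μ ν) = 4 * N * ekAction U := by
  have hN' : (0 : ℝ) < 4 * N := by positivity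
  rw [ekAction_eq_sum_ekCommNormSq hN U, Finset.mul_sum]
  refine Finset.sum_congr rfl fun μ _ => ?_
  rw [Finset.mul_sum]
  refine Finset.sum_congr rfl fun ν _ => ?_
  rw [ekCommNormSq_eq_frobSq]
  field_simp

/-- The action event is contained in the rank-robust event (take `R ≡ 0`). -/
theorem actionEvent_subset_robustEvent {N : ℕ} (hN : 0 < N) (κ : ℝ) (hκ : 0 ≤ κ) (t : ℝ) :
    {U : EKConfig 3 N | ekAction U ≤ t} ⊆
      {U | ∃ R : Fin 3 → Fin 3 → Matrix (Fin N) (Fin N) ℂ,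
        (∀ μ ν, ((R μ ν).rank : ℝ) ≤ κ * N) ∧ ∑ μ, ∑ ν, frobSq (ekComm U μ ν - R μ ν) ≤ 4 * N * t} := by
  intro U hU
  refine ⟨fun _ _ => 0, fun μ ν => ?_, ?_⟩
  · simp only [Matrix.rank_zero, Nat.cast_zero]; positivity
  · simp only [sub_zero]
    rw [sum_frobSq_ekComm_eq hN U]
    have hN' : (0 : ℝ) ≤ 4 * N := by positivity
    exact mul_le_mul_of_nonneg_left hU hN'

/-- **(a♯) ⇒ (a′)**: the rank-robust bound implies `FreeTripleSmallBallLe1` (take `R ≡ 0`). -/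
theorem freeTripleSmallBallLe1_of_robust (h : FreeTripleSmallBallRobust) : FreeTripleSmallBallLe1 := by
  intro η hη
  obtain ⟨κ, hκ, C, hC, N₀, hb⟩ := h η hη
  refine ⟨C, hC, max N₀ 1, fun N hN t ht ht1 => ?_⟩
  have hN₀ : N₀ ≤ N := le_trans (le_max_left _ _) hN
  have hN1 : 0 < N := lt_of_lt_of_le Nat.one_pos (le_trans (le_max_right _ _) hN)
  exact le_trans (measure_mono (actionEvent_subset_robustEvent hN1 κ hκ.le t)) (hb N hN₀ t ht ht1)

/-- Composition (as in the registered skeleton's `TripleSmallBallMargin_of ha hb := marginComposition_proof centreSymmetricProfile_proof (hb ha)`):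
the two v6 stubs and the LANDED glue (d), (c) give the route's crux `TripleSmallBallMargin` by name.  Kernel-checked bookkeeping; nothing is
proved about the stubs here. -/
theorem tripleSmallBallMargin_of_robust_stubs (ha : FreeTripleSmallBallRobust) (hb : OffBlockDecouplingRobust) :
    Summit.QuantumFields.YangMills.Theses.EguchiKawaiDirectionLadder.TripleSmallBallMargin :=
  marginComposition_proof centreSymmetricProfile_proof (hb ha)

end Summit.QuantumFields.YangMills.Theorems.EguchiKawaiDirectionLadder

end
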